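import Summits.NavierStokesRegularity.NavierStokesRegularity.Theorems.AdaptedFrequencyAdaptedFrequencyConvergesStubBlockSolverCorrectorCore
import Mathlib.Analysis.Calculus.BumpFunction.FiniteDimension

/-!
# Crux `AdaptedFrequencyConverges` (stmt-NavierStokesRegularity-10493), line
  `cloud-frame-effective-tsai`: the very weak `L²` corrector for STUB `stub_blockSolver`
  (drift smooth on a half-open slab, cut off in time)

Helper file (lands `--supports stmt-NavierStokesRegularity-10493`).  For `ν > 0`, times
`tb < ta < T₁ < Ta < T`, a drift `b` jointly smooth on `Ico tb T × ℝ³`, divergence free, bounded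
and vanishing on `[T₁, T)`, and the backward caloric extension `F(t, x) = e^{ν(T−t)Δ}f(x)` of
smooth compactly supported data, there is a measurable `w ∈ L²(ℝ × ℝ³)`, vanishing off the strip
`(ta, Ta) × ℝ³`, such that `F + w` is a very weak solution of `∂ₜG + b·∇G + νΔG = 0` on the
open slab `(ta, T) × ℝ³` (`corrector_cutoff`).

This is the tree's `stub_weakCorrector` (file `…AdaptedKernelExistsWeakCorrector`) VERBATIM with
the backward heat kernel replaced by `F`: the drift is globalised by a smooth time cut-off `η`
(`ContDiffBump`; `= 1` on `[ta, T₁]`, supported in `(tb, T)`), `ηb` is globally smooth, bounded,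
has divergence-free slices, vanishes for `t ≥ T₁`, and `ηb = b` on `[ta, T) × ℝ³`, which contains
the supports of all test functions of the very weak form; then `corrector_core` applies.
-/

noncomputable section

open MeasureTheory Set Filter Topology Metric Function
open scoped ContDiff Laplacian InnerProductSpace
open Literature.Analysis.FluidPDE Literature.Analysis.UnboundedOperators
open Summit.NavierStokesRegularity.NavierStokesRegularity.Theorems.AdaptedKernelExists.NashEntropyLastBlock

namespace Summit.NavierStokesRegularity.NavierStokesRegularity.Theorems.AdaptedFrequencyConverges.CloudFrameEffectiveTsai

variable {ν T tb ta T₁ Ta B : ℝ} {f : EuclideanSpace ℝ (Fin 3) → ℝ}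
  {F : ℝ → EuclideanSpace ℝ (Fin 3) → ℝ}
  {b : ℝ → EuclideanSpace ℝ (Fin 3) → EuclideanSpace ℝ (Fin 3)}

/-- **The very weak `L²` corrector of the caloric extension for a cut-off drift** (Lions'
projection lemma after globalising the drift by a time cut-off): see the module docstring. -/
theorem corrector_cutoff (hν : 0 < ν) (hf : ContDiff ℝ 2 f) (hfc : HasCompactSupport f)
    (hF : F = fun t x => heatExtension f (ν * (T - t)) x) (htb : tb < ta) (hta : ta < T₁)
    (hT₁ : T₁ < Ta) (hTa : Ta < T) (hb : IsSmoothSpaceTimeOn (Ico tb T) b)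
    (hdiv : ∀ t ∈ Ico tb T, VectorCalculus.IsDivFree (b t))
    (hB : ∀ t ∈ Ico tb T, ∀ x, ‖b t x‖ ≤ B) (hb0 : ∀ t ∈ Ico T₁ T, ∀ x, b t x = 0) :
    ∃ w : ℝ × EuclideanSpace ℝ (Fin 3) → ℝ,
      Measurable w ∧ MemLp w 2 volume ∧
      (∀ p, p.1 ∉ Ioo ta Ta → w p = 0) ∧
      LocallyIntegrableOn (fun p => F p.1 p.2 + w p) (Ioo ta T ×ˢ univ) volume ∧
      ∀ φ : ℝ × EuclideanSpace ℝ (Fin 3) → ℝ, ContDiff ℝ ∞ φ → HasCompactSupport φ →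
        tsupport φ ⊆ Ioo ta T ×ˢ univ →
        ∫ p, (F p.1 p.2 + w p) *
            (deriv (fun s => φ (s, p.2)) p.1 +
              fderiv ℝ (fun y => φ (p.1, y)) p.2 (b p.1 p.2) -
              ν * (Δ (fun y => φ (p.1, y))) p.2) = 0 := by
  -- the time cut-off `η`: `= 1` on `[ta, T₁]`, supported in `(tb, T)`
  set c₀ : ℝ := (ta + T₁) / 2 with hc₀
  set r₁ : ℝ := (T₁ - ta) / 2 with hr₁
  set δ : ℝ := min (ta - tb) (T - T₁) / 2 with hδ
  have hδ0 : 0 < δ := by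
    rw [hδ]; have := lt_min (sub_pos.2 htb) (sub_pos.2 (hT₁.trans hTa)); linarith
  have hδ1 : δ ≤ (ta - tb) / 2 := by
    rw [hδ]; linarith [min_le_left (ta - tb) (T - T₁)]
  have hδ2 : δ ≤ (T - T₁) / 2 := by
    rw [hδ]; linarith [min_le_right (ta - tb) (T - T₁)]
  have hr₁0 : 0 < r₁ := by rw [hr₁]; linarith
  let η : ContDiffBump c₀ := ⟨r₁, r₁ + δ, hr₁0, by linarith⟩
  have hη1 : ∀ t ∈ Icc ta T₁, η t = 1 := fun t ht =>
    η.one_of_mem_closedBall (by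
      rw [mem_closedBall, Real.dist_eq, abs_le]
      show -r₁ ≤ t - c₀ ∧ t - c₀ ≤ r₁
      constructor <;> linarith [ht.1, ht.2, hc₀, hr₁])
  have hηfar : ∀ t, t ∉ Ioo tb T → r₁ + δ < dist t c₀ := by
    intro t ht
    rw [Real.dist_eq]
    rcases le_or_gt t tb with h | h
    · rw [abs_of_nonpos (by rw [hc₀]; linarith)]
      rw [hc₀, hr₁]; linarith
    · have hT : T ≤ t := not_lt.1 fun h' => ht ⟨h, h'⟩
      rw [abs_of_nonneg (by rw [hc₀]; linarith)]
      rw [hc₀, hr₁]; linarith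
  have hη0 : ∀ t, t ∉ Ioo tb T → η t = 0 := fun t ht => η.zero_of_le_dist (hηfar t ht).le
  have hηev : ∀ t, t ∉ Ioo tb T → (η : ℝ → ℝ) =ᶠ[𝓝 t] 0 := fun t ht =>
    notMem_tsupport_iff_eventuallyEq.1 (by
      rw [η.tsupport_eq]
      exact fun h => (not_le.2 (hηfar t ht)) (mem_closedBall.1 h))
  -- the globalised drift
  set b' : ℝ → EuclideanSpace ℝ (Fin 3) → EuclideanSpace ℝ (Fin 3) := fun t x => η t • b t x
    with hb'
  have hb'eq : ∀ t ∈ Ico ta T, ∀ x, b' t x = b t x := by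
    intro t ht x
    simp only [hb']
    rcases le_or_gt t T₁ with h | h
    · rw [hη1 t ⟨ht.1, h⟩, one_smul]
    · rw [hb0 t ⟨h.le, ht.2⟩ x, smul_zero]
  have hb's : ContDiff ℝ ∞ (uncurry b') := by
    rw [contDiff_iff_contDiffAt]
    intro p
    by_cases hp : p.1 ∈ Ioo tb T
    · have hbp : ContDiffAt ℝ ∞ (uncurry b) p :=
        (hb.mono Ioo_subset_Ico_self).contDiffAt isOpen_Ioo hp p.2
      have hηs : ContDiff ℝ ∞ (η : ℝ → ℝ) := η.contDiff
      exact (hηs.contDiffAt.comp p contDiffAt_fst).smul hbp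
    · have hev : uncurry b' =ᶠ[𝓝 p] fun _ => 0 := by
        have h2 := (hηev p.1 hp).comp_tendsto (continuous_fst.tendsto p)
        filter_upwards [h2] with q hq
        have hq' : η q.1 = 0 := hq
        simp only [hb', uncurry, hq', zero_smul]
      exact contDiffAt_const.congr_of_eventuallyEq hev
  have hdiv' : ∀ t, VectorCalculus.IsDivFree (b' t) := by
    intro t x
    by_cases ht : t ∈ Ico tb T
    · have hd : DifferentiableAt ℝ (b t) x :=
        (hb.contDiff_slice ht).differentiable (by simp) x
      have h1 : fderiv ℝ (b' t) x = η t • fderiv ℝ (b t) x := by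
        simp only [hb']
        exact fderiv_const_smul hd (η t)
      unfold VectorCalculus.divergence
      rw [h1, ContinuousLinearMap.toLinearMap_smul, map_smul, smul_eq_mul]
      have := hdiv t ht x
      unfold VectorCalculus.divergence at this
      rw [this, mul_zero]
    · have ht' : t ∉ Ioo tb T := fun h => ht (Ioo_subset_Ico_self h)
      have h0 : b' t = fun _ => 0 := by
        funext y; simp only [hb', hη0 t ht', zero_smul]
      unfold VectorCalculus.divergence
      rw [h0, fderiv_const_apply]
      simp
  have hB0 : 0 ≤ B := (norm_nonneg _).trans (hB ta ⟨htb.le, by linarith⟩ 0)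
  have hB' : ∀ t x, ‖b' t x‖ ≤ B := by
    intro t x
    simp only [hb', norm_smul, Real.norm_eq_abs, abs_of_nonneg η.nonneg]
    by_cases ht : t ∈ Ico tb T
    · calc η t * ‖b t x‖ ≤ 1 * B := mul_le_mul η.le_one (hB t ht x) (norm_nonneg _) zero_le_one
        _ = B := one_mul B
    · rw [hη0 t (fun h => ht (Ioo_subset_Ico_self h)), zero_mul]
      exact hB0
  have hb'0 : ∀ t, T₁ ≤ t → ∀ x, b' t x = 0 := by
    intro t ht x
    simp only [hb']
    by_cases h : t < T
    · rw [hb0 t ⟨ht, h⟩ x, smul_zero]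
    · rw [hη0 t (fun h' => h h'.2), zero_smul]
  obtain ⟨w, hwm, hw2, hw0, hloc, hweak⟩ :=
    corrector_core hν hf hfc hF hta hT₁ hTa hb's hdiv' hB' hb'0
  refine ⟨w, hwm, hw2, hw0, hloc, fun φ hφ hφc hφT => ?_⟩
  rw [← hweak φ hφ hφc hφT]
  refine integral_congr_ae (Eventually.of_forall fun p => ?_)
  dsimp only
  by_cases hp : p ∈ tsupport φ
  · have h1 : p.1 ∈ Ioo ta T := (hφT hp).1
    rw [hb'eq p.1 ⟨h1.1.le, h1.2⟩ p.2]
  · rw [weakCorrector_fderiv_slice_eq_zero (weakCorrector_contDiff_one_of_infty hφ) hp,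
      weakCorrector_fderiv_slice_eq_zero (weakCorrector_contDiff_one_of_infty hφ) hp]


/-! ### Registered sub-goal -/

/-- **Registered sub-goal `stub_blockSolver_corrector`** (closed form of `corrector_cutoff`,
sub-goal of STUB `stub_blockSolver`): the very weak `L²` corrector of the caloric extension for a
drift smooth on a half-open slab, cut off in time. -/
theorem stub_blockSolver_corrector :
    ∀ (ν T tb ta T₁ Ta B : ℝ) (f : (EuclideanSpace ℝ (Fin 3)) → ℝ) (b : ℝ → (EuclideanSpace ℝ (Fin 3)) → (EuclideanSpace ℝ (Fin 3))), 0 < ν → ContDiff ℝ 2 f → HasCompactSupport f → tb < ta → ta < T₁ → T₁ < Ta → Ta < T → IsSmoothSpaceTimeOn (Ico tb T) b → (∀ t ∈ Ico tb T, VectorCalculus.IsDivFree (b t)) → (∀ t ∈ Ico tb T, ∀ x, ‖b t x‖ ≤ B) → (∀ t ∈ Ico T₁ T, ∀ x, b t x = 0) → ∃ w : ℝ × (EuclideanSpace ℝ (Fin 3)) → ℝ, Measurable w ∧ MemLp w 2 volume ∧ (∀ p, p.1 ∉ Ioo ta Ta → w p = 0) ∧ LocallyIntegrableOn (fun p =>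 Literature.Analysis.UnboundedOperators.heatExtension f (ν * (T - p.1)) p.2 + w p) (Ioo ta T ×ˢ univ) volume ∧ ∀ φ : ℝ × (EuclideanSpace ℝ (Fin 3)) → ℝ, ContDiff ℝ (⊤ : ℕ∞) φ → HasCompactSupport φ → tsupport φ ⊆ Ioo ta T ×ˢ univ → ∫ p, (Literature.Analysis.UnboundedOperators.heatExtension f (ν * (T - p.1)) p.2 + w p) * (deriv (fun s => φ (s, p.2)) p.1 + fderiv ℝ (fun y => φ (p.1, y)) p.2 (b p.1 p.2) - ν * Laplacian.laplacian (fun y => φ (p.1, y)) p.2) = 0 :=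
  fun _ _ _ _ _ _ _ _ _ hν hf hfc htb hta hT₁ hTa hb hdiv hB hb0 =>
    corrector_cutoff hν hf hfc rfl htb hta hT₁ hTa hb hdiv hB hb0

end Summit.NavierStokesRegularity.NavierStokesRegularity.Theorems.AdaptedFrequencyConverges.CloudFrameEffectiveTsai

end
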